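import Summits.BirchSwinnertonDyer.BirchSwinnertonDyer.Theses.PlecticLegs
import Literature.Barriers.BirchSwinnertonDyer.RankNotSumOfLocalInvariantsC3C3Proofs
import Literature.Barriers.BirchSwinnertonDyer.RankNotSumOfLocalInvariantsF4TwistPoints
import Literature.NumberTheory.EllipticCurves.TwoDescentLinearConditions
import Literature.NumberTheory.QuadraticFields.FundamentalDiscriminant
import Mathlib.Tactic.NormNum.Prime

/-!
# Negative lemma for crux `PlecticLegs.PlecticRankUB` (stmt-BirchSwinnertonDyer-17519):
# the analytic-rank hypothesis `V.analyticRank = [F:ℚ]` is load-bearing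

Refuter / crux-disprover file (Negative lane, supports stmt-BirchSwinnertonDyer-17519; it does NOT
refute the crux). `PlecticRankUB` reads
`∀ F [NumberField F] [IsTotallyReal F] (V : WeierstrassCurve F) [V.IsElliptic],
2 ≤ [F:ℚ] → V.analyticRank = [F:ℚ] → rank_ℤ V(F) ≤ [F:ℚ]`.
We record, sorry-free, that the statement with the analytic hypothesis `V.analyticRank = [F:ℚ]`
DROPPED is FALSE: over the real quadratic field `F = ℚ(√5)` (`d_F = 5 > 0`, totally real,
`[F:ℚ] = 2`) the base change of the congruent number curve `E₁₂₅₄ : y² = x³ − 1254² x`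
(`1254 = 2·3·11·19`, the least congruent number of rank `3`) has Mordell–Weil rank `≥ 3 > 2`.
The rank bound is certified in Lean by the complete `2`-descent characters of the tree
(`le_mordellWeilRank_of_twoTorsion'`, Silverman AEC Prop. X.1.4, made honest by the proved
Mordell–Weil theorem `module_finite_point_holds`): the three integral points
`P₁ = (−912, 25992)`, `P₂ = (−528, 26136)`, `P₃ = (1650, 43560)` have sign/valuation-parity
vectors `(v₂, v₃, v₁₁, v₁₉)(x + 1254), sgn(x)` equal to `[1,0,0,1,1]`, `[1,1,0,0,1]`, `[1,1,0,0,0]`,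
`𝔽₂`-independent of those of the `2`-torsion `T₁ = (−1254, 0) ↦ [1,0,0,0,1]`,
`T₂ = (0,0) ↦ [1,1,1,1,1]` (points and bit-vectors found by PARI/GP `ellrank`, kit job j023556;
every claim re-verified by the kernel), and the rank does not drop under base change
(`mordellWeilRank_baseChange_le_of_algHom`).

Consequences for provers of `PlecticRankUB` (see the crux work-file
`Cruxes/PlecticRankUB/Disproof.lean`): the conclusion is not a property of totally real fields or
of the degree — every bit of the upper bound must come out of `ord_{s=1} L(V/F,s) = [F:ℚ]`, i.e.
from an Euler/Kolyvagin-system-type input of rank `[F:ℚ]`; in particular nothing weaker than the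
exact order (e.g. parity, or the vanishing `L(V/F,1) = 0` alone) can suffice, since `E₁₂₅₄/ℚ(√5)`
has `L(V/F,1) = 0` as well. [folklore]
-/

noncomputable section

open scoped Classical

open WeierstrassCurve WeierstrassCurve.Affine WeierstrassCurve.Affine.Point
open Literature.NumberTheory.EllipticCurves Literature.NumberTheory.EllipticCurves.KramerTwoDescent
open Literature.NumberTheory.EllipticCurves.TwoDescentLocal
open Literature.Barriers.BirchSwinnertonDyer.DokchitserDokchitser2011

namespace Summit.BirchSwinnertonDyer.BirchSwinnertonDyer.Theorems

/-- Rational `2`-torsion `-1254, 0, 1254` of `E₁₂₅₄ : y² = x³ − 1254² x`. [folklore] -/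
theorem PlecticRankUBNegative.hsplit :
    (congruentNumberCurve 1254).toAffine.SplitTwoTorsion (-1254) 0 1254 := by
  have h := splitTwoTorsion_cn 1254
  norm_num at h
  exact h

/-- **`3 ≤ rk E₁₂₅₄(ℚ)`** by the complete `2`-descent (Silverman AEC Prop. X.1.4): with
`ψ = (v₂, v₃, v₁₁, v₁₉ of δ₁ = x + 1254, sign of δ₂ = x) : E(ℚ) → 𝔽₂⁵`, the values at
`P₁ = (−912, 25992)`, `P₂ = (−528, 26136)`, `P₃ = (1650, 43560)`, `T₁ = (−1254, 0)`, `T₂ = (0, 0)`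
are `𝔽₂`-linearly independent. [cite: SilvermanAEC2009, Prop. X.1.4] -/
theorem PlecticRankUBNegative.three_le_mordellWeilRank_1254 :
    3 ≤ (congruentNumberCurve 1254).mordellWeilRank := by
  haveI hE : (congruentNumberCurve 1254).IsElliptic := isElliptic_congruentNumberCurve (by norm_num)
  haveI h11 : Fact (Nat.Prime 11) := ⟨by norm_num⟩
  haveI h19 : Fact (Nat.Prime 19) := ⟨by norm_num⟩
  have hsplit := PlecticRankUBNegative.hsplit
  -- the descent characters, as an opaque homomorphism with its values
  obtain ⟨ψ, hψ⟩ : ∃ ψ : (congruentNumberCurve 1254).toAffine.Point →+ (Fin 5 → ZMod 2),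
      ∀ P, ψ P = ![charFst hsplit (parityHom 2) P, charFst hsplit (parityHom 3) P,
        charFst hsplit (parityHom 11) P, charFst hsplit (parityHom 19) P, charSnd hsplit signHom P] :=
    ⟨AddMonoidHom.pi fun i => (![charFst hsplit (parityHom 2), charFst hsplit (parityHom 3),
        charFst hsplit (parityHom 11), charFst hsplit (parityHom 19), charSnd hsplit signHom] :
          Fin 5 → ((congruentNumberCurve 1254).toAffine.Point →+ ZMod 2)) i,
      fun P => by ext i; fin_cases i <;> rfl⟩
  -- `ψ` off the `2`-torsion
  have ψ_some : ∀ {x y : ℚ} (hP : (congruentNumberCurve 1254).toAffine.Nonsingular x y),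
      x ≠ -1254 → x ≠ 0 → ψ (.some x y hP) = ![parityBit 2 (x - -1254), parityBit 3 (x - -1254),
        parityBit 11 (x - -1254), parityBit 19 (x - -1254), signBit (x - 0)] := by
    intro x y hP hx₁ hx₂
    have hx₁' : x - -1254 ≠ 0 := sub_ne_zero.mpr hx₁
    have hx₂' : x - 0 ≠ 0 := sub_ne_zero.mpr hx₂
    rw [hψ]
    ext i
    fin_cases i
    · show charFst hsplit (parityHom 2) (.some x y hP) = parityBit 2 (x - -1254)
      rw [charFst_apply, twoDescentComponent_some_of_ne hP hx₁, parityHom_sqClass hx₁']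
    · show charFst hsplit (parityHom 3) (.some x y hP) = parityBit 3 (x - -1254)
      rw [charFst_apply, twoDescentComponent_some_of_ne hP hx₁, parityHom_sqClass hx₁']
    · show charFst hsplit (parityHom 11) (.some x y hP) = parityBit 11 (x - -1254)
      rw [charFst_apply, twoDescentComponent_some_of_ne hP hx₁, parityHom_sqClass hx₁']
    · show charFst hsplit (parityHom 19) (.some x y hP) = parityBit 19 (x - -1254)
      rw [charFst_apply, twoDescentComponent_some_of_ne hP hx₁, parityHom_sqClass hx₁']
    · show charSnd hsplit signHom (.some x y hP) = signBit (x - 0)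
      rw [charSnd_apply, twoDescentComponent_some_of_ne hP hx₂, signHom_sqClass hx₂']
  -- `ψ(T₁)`, `T₁ = (-1254, 0)`: `δ₁ = (e₁-e₂)(e₁-e₃) = 2·1254² = 2³·627²`, `δ₂ = -1254`
  have ψ_T1 : ψ (.some _ _ (nonsingular_twoTorsion hsplit)) = ![1, 0, 0, 0, 1] := by
    have h₁ : (((-1254 : ℚ) - 0) * ((-1254 : ℚ) - 1254)) ≠ 0 := by norm_num
    have h₂ : ((-1254 : ℚ) - 0) ≠ 0 := by norm_num
    rw [hψ]
    ext i
    fin_cases i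
    · show charFst hsplit (parityHom 2) _ = 1
      rw [charFst_apply, twoDescentComponent_some_of_eq _ rfl, parityHom_sqClass h₁]
      exact parityBit_eq_of_eq 2 3 (u := 393129) (v := 1) (1) (Or.inl rfl) (by norm_num) (by norm_num) (by norm_num)
    · show charFst hsplit (parityHom 3) _ = 0
      rw [charFst_apply, twoDescentComponent_some_of_eq _ rfl, parityHom_sqClass h₁]
      exact parityBit_eq_of_eq 3 2 (u := 349448) (v := 1) (1) (Or.inl rfl) (by norm_num) (by norm_num) (by norm_num)
    · show charFst hsplit (parityHom 11) _ = 0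
      rw [charFst_apply, twoDescentComponent_some_of_eq _ rfl, parityHom_sqClass h₁]
      exact parityBit_eq_of_eq 11 2 (u := 25992) (v := 1) (1) (Or.inl rfl) (by norm_num) (by norm_num) (by norm_num)
    · show charFst hsplit (parityHom 19) _ = 0
      rw [charFst_apply, twoDescentComponent_some_of_eq _ rfl, parityHom_sqClass h₁]
      exact parityBit_eq_of_eq 19 2 (u := 8712) (v := 1) (1) (Or.inl rfl) (by norm_num) (by norm_num) (by norm_num)
    · show charSnd hsplit signHom _ = 1
      rw [charSnd_apply, twoDescentComponent_some_of_ne _ (by norm_num), signHom_sqClass h₂]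
      exact signBit_of_neg (by norm_num)
  -- `ψ(T₂)`, `T₂ = (0, 0)`: `δ₁ = 1254 = 2·3·11·19`, `δ₂ = (e₂-e₁)(e₂-e₃) = -1254² < 0`
  have ψ_T2 : ψ (.some _ _ (nonsingular_twoTorsion hsplit.swap₁₂)) = ![1, 1, 1, 1, 1] := by
    have h₁ : ((0 : ℚ) - -1254) ≠ 0 := by norm_num
    have h₂ : (((0 : ℚ) - -1254) * ((0 : ℚ) - 1254)) ≠ 0 := by norm_num
    rw [hψ]
    ext i
    fin_cases i
    · show charFst hsplit (parityHom 2) _ = 1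
      rw [charFst_apply, twoDescentComponent_some_of_ne _ (by norm_num), parityHom_sqClass h₁]
      exact parityBit_eq_of_eq 2 1 (u := 627) (v := 1) (1) (Or.inl rfl) (by norm_num) (by norm_num) (by norm_num)
    · show charFst hsplit (parityHom 3) _ = 1
      rw [charFst_apply, twoDescentComponent_some_of_ne _ (by norm_num), parityHom_sqClass h₁]
      exact parityBit_eq_of_eq 3 1 (u := 418) (v := 1) (1) (Or.inl rfl) (by norm_num) (by norm_num) (by norm_num)
    · show charFst hsplit (parityHom 11) _ = 1
      rw [charFst_apply, twoDescentComponent_some_of_ne _ (by norm_num), parityHom_sqClass h₁]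
      exact parityBit_eq_of_eq 11 1 (u := 114) (v := 1) (1) (Or.inl rfl) (by norm_num) (by norm_num) (by norm_num)
    · show charFst hsplit (parityHom 19) _ = 1
      rw [charFst_apply, twoDescentComponent_some_of_ne _ (by norm_num), parityHom_sqClass h₁]
      exact parityBit_eq_of_eq 19 1 (u := 66) (v := 1) (1) (Or.inl rfl) (by norm_num) (by norm_num) (by norm_num)
    · show charSnd hsplit signHom _ = 1
      rw [charSnd_apply, twoDescentComponent_some_of_eq _ rfl, signHom_sqClass h₂]
      exact signBit_of_neg (by norm_num)
  -- `ψ(T₃)`, `T₃ = (1254, 0)`: `δ₁ = 2508 = 2²·3·11·19`, `δ₂ = 1254 > 0`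
  have ψ_T3 : ψ (.some _ _ (nonsingular_twoTorsion hsplit.swap₂₃.swap₁₂)) = ![0, 1, 1, 1, 0] := by
    have h₁ : ((1254 : ℚ) - -1254) ≠ 0 := by norm_num
    have h₂ : ((1254 : ℚ) - 0) ≠ 0 := by norm_num
    rw [hψ]
    ext i
    fin_cases i
    · show charFst hsplit (parityHom 2) _ = 0
      rw [charFst_apply, twoDescentComponent_some_of_ne _ (by norm_num), parityHom_sqClass h₁]
      exact parityBit_eq_of_eq 2 2 (u := 627) (v := 1) (1) (Or.inl rfl) (by norm_num) (by norm_num) (by norm_num)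
    · show charFst hsplit (parityHom 3) _ = 1
      rw [charFst_apply, twoDescentComponent_some_of_ne _ (by norm_num), parityHom_sqClass h₁]
      exact parityBit_eq_of_eq 3 1 (u := 836) (v := 1) (1) (Or.inl rfl) (by norm_num) (by norm_num) (by norm_num)
    · show charFst hsplit (parityHom 11) _ = 1
      rw [charFst_apply, twoDescentComponent_some_of_ne _ (by norm_num), parityHom_sqClass h₁]
      exact parityBit_eq_of_eq 11 1 (u := 228) (v := 1) (1) (Or.inl rfl) (by norm_num) (by norm_num) (by norm_num)
    · show charFst hsplit (parityHom 19) _ = 1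
      rw [charFst_apply, twoDescentComponent_some_of_ne _ (by norm_num), parityHom_sqClass h₁]
      exact parityBit_eq_of_eq 19 1 (u := 132) (v := 1) (1) (Or.inl rfl) (by norm_num) (by norm_num) (by norm_num)
    · show charSnd hsplit signHom _ = 0
      rw [charSnd_apply, twoDescentComponent_some_of_ne _ (by norm_num), signHom_sqClass h₂]
      exact signBit_of_nonneg (by norm_num)
  -- the three points
  have hP1 : (congruentNumberCurve 1254).toAffine.Nonsingular (-912) 25992 :=
    (cn_nonsingular_iff (n := 1254) (by norm_num) _ _).mpr (by norm_num)
  have hP2 : (congruentNumberCurve 1254).toAffine.Nonsingular (-528) 26136 :=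
    (cn_nonsingular_iff (n := 1254) (by norm_num) _ _).mpr (by norm_num)
  have hP3 : (congruentNumberCurve 1254).toAffine.Nonsingular 1650 43560 :=
    (cn_nonsingular_iff (n := 1254) (by norm_num) _ _).mpr (by norm_num)
  -- `ψ(P₁)`: `x + 1254 = 342 = 2·3²·19`, `x = -912 < 0`
  have ψ_pt1 : ψ (.some _ _ hP1) = ![1, 0, 0, 1, 1] := by
    rw [ψ_some hP1 (by norm_num) (by norm_num)]
    ext i
    fin_cases i
    · show parityBit 2 _ = 1
      exact parityBit_eq_of_eq 2 1 (u := 171) (v := 1) (1) (Or.inl rfl) (by norm_num) (by norm_num) (by norm_num)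
    · show parityBit 3 _ = 0
      exact parityBit_eq_of_eq 3 2 (u := 38) (v := 1) (1) (Or.inl rfl) (by norm_num) (by norm_num) (by norm_num)
    · show parityBit 11 _ = 0
      exact parityBit_eq_of_eq 11 0 (u := 342) (v := 1) (1) (Or.inl rfl) (by norm_num) (by norm_num) (by norm_num)
    · show parityBit 19 _ = 1
      exact parityBit_eq_of_eq 19 1 (u := 18) (v := 1) (1) (Or.inl rfl) (by norm_num) (by norm_num) (by norm_num)
    · show signBit _ = 1
      exact signBit_of_neg (by norm_num)
  -- `ψ(P₂)`: `x + 1254 = 726 = 2·3·11²`, `x = -528 < 0`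
  have ψ_pt2 : ψ (.some _ _ hP2) = ![1, 1, 0, 0, 1] := by
    rw [ψ_some hP2 (by norm_num) (by norm_num)]
    ext i
    fin_cases i
    · show parityBit 2 _ = 1
      exact parityBit_eq_of_eq 2 1 (u := 363) (v := 1) (1) (Or.inl rfl) (by norm_num) (by norm_num) (by norm_num)
    · show parityBit 3 _ = 1
      exact parityBit_eq_of_eq 3 1 (u := 242) (v := 1) (1) (Or.inl rfl) (by norm_num) (by norm_num) (by norm_num)
    · show parityBit 11 _ = 0
      exact parityBit_eq_of_eq 11 2 (u := 6) (v := 1) (1) (Or.inl rfl) (by norm_num) (by norm_num) (by norm_num)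
    · show parityBit 19 _ = 0
      exact parityBit_eq_of_eq 19 0 (u := 726) (v := 1) (1) (Or.inl rfl) (by norm_num) (by norm_num) (by norm_num)
    · show signBit _ = 1
      exact signBit_of_neg (by norm_num)
  -- `ψ(P₃)`: `x + 1254 = 2904 = 2³·3·11²`, `x = 1650 > 0`
  have ψ_pt3 : ψ (.some _ _ hP3) = ![1, 1, 0, 0, 0] := by
    rw [ψ_some hP3 (by norm_num) (by norm_num)]
    ext i
    fin_cases i
    · show parityBit 2 _ = 1
      exact parityBit_eq_of_eq 2 3 (u := 363) (v := 1) (1) (Or.inl rfl) (by norm_num) (by norm_num) (by norm_num)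
    · show parityBit 3 _ = 1
      exact parityBit_eq_of_eq 3 1 (u := 968) (v := 1) (1) (Or.inl rfl) (by norm_num) (by norm_num) (by norm_num)
    · show parityBit 11 _ = 0
      exact parityBit_eq_of_eq 11 2 (u := 24) (v := 1) (1) (Or.inl rfl) (by norm_num) (by norm_num) (by norm_num)
    · show parityBit 19 _ = 0
      exact parityBit_eq_of_eq 19 0 (u := 2904) (v := 1) (1) (Or.inl rfl) (by norm_num) (by norm_num) (by norm_num)
    · show signBit _ = 0
      exact signBit_of_nonneg (by norm_num)
  -- independence
  refine le_mordellWeilRank_of_twoTorsion' hsplit ψ ![.some _ _ hP1, .some _ _ hP2, .some _ _ hP3] ?_ ?_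
  · rw [ψ_T1, ψ_T2, ψ_T3]; decide
  · intro c ε₁ ε₂ hc
    simp only [Fin.sum_univ_succ, Fin.sum_univ_zero, Matrix.cons_val_zero, Matrix.cons_val_succ,
      ψ_pt1, ψ_pt2, ψ_pt3, ψ_T1, ψ_T2] at hc
    revert hc ε₁ ε₂ c
    decide

/-- **`PlecticRankUB` is false without the analytic-rank hypothesis** (load-bearing hypothesis;
negative lemma supporting stmt-BirchSwinnertonDyer-17519, not a refutation of it). The negated
statement is the body of `PlecticLegs.PlecticRankUB` verbatim with the single hypothesis
`V.analyticRank = Module.finrank ℚ F` deleted (it is `PlecticRankUBWithoutAnalyticRank` of the crux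
work-file `Cruxes/PlecticRankUB/Disproof.lean`). Witness: `F = ℚ(√5)` (the quadratic field of
discriminant `5`: totally real, `[F:ℚ] = 2`), `V = E₁₂₅₄ ⊗ F` with
`rank_ℤ V(F) ≥ rank_ℤ E₁₂₅₄(ℚ) ≥ 3 > 2 = [F:ℚ]`. [folklore] -/
theorem plecticRankUB_false_without_analyticRank :
    ¬ (∀ (F : Type) [Field F] [NumberField F] [NumberField.IsTotallyReal F]
        (V : WeierstrassCurve F) [V.IsElliptic],
        2 ≤ Module.finrank ℚ F → V.mordellWeilRank ≤ Module.finrank ℚ F) := by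
  intro h
  -- the real quadratic field of discriminant 5
  obtain ⟨K, _, _, h2, hdK⟩ :=
    Literature.NumberTheory.QuadraticFields.Quadratic.exists_numberField_discr_eq (D := 5)
      (Or.inl ⟨by norm_num, by rw [← Int.squarefree_natAbs]; exact Nat.prime_five.squarefree,
        by norm_num⟩)
  haveI : NumberField.IsTotallyReal K := by
    rw [← NumberField.nrComplexPlaces_eq_zero_iff]
    have hsign := NumberField.sign_discr K
    rw [hdK] at hsign
    have heven : Even (NumberField.InfinitePlace.nrComplexPlaces K) := by
      by_contra hodd
      rw [Nat.not_even_iff_odd] at hodd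
      rw [hodd.neg_one_pow] at hsign
      norm_num at hsign
    have hrk := NumberField.InfinitePlace.card_add_two_mul_card_eq_rank K
    rw [h2] at hrk
    obtain ⟨m, hm⟩ := heven
    omega
  haveI hE : (congruentNumberCurve 1254).IsElliptic := isElliptic_congruentNumberCurve (by norm_num)
  haveI : ((congruentNumberCurve 1254).baseChange K).IsElliptic :=
    inferInstanceAs ((congruentNumberCurve 1254).map (algebraMap ℚ K)).IsElliptic
  have hle := h K ((congruentNumberCurve 1254).baseChange K) (by omega)
  have hmono := mordellWeilRank_baseChange_le_of_algHom (F := K) (congruentNumberCurve 1254)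
    (Algebra.ofId ℚ K)
  have hid : (congruentNumberCurve 1254).baseChange ℚ = congruentNumberCurve 1254 := by
    rw [WeierstrassCurve.baseChange, RingHom.ext_rat (algebraMap ℚ ℚ) (RingHom.id ℚ),
      WeierstrassCurve.map_id]
  rw [hid] at hmono
  have h3 := PlecticRankUBNegative.three_le_mordellWeilRank_1254
  omega

end Summit.BirchSwinnertonDyer.BirchSwinnertonDyer.Theorems

end
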